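import Summits.AtomisticToContinuum.BoseEinsteinCondensation.Theses.BECSectorPoincareTwoScale

/-!
# Route `BECSectorPoincareTwoScale`, assembly item `Assembly` (stmt-AtomisticToContinuum-9098)

Settles the assembly item `stmt-AtomisticToContinuum-9098` of route
`route-AtomisticToContinuum-BECSectorPoincareTwoScale`: the implication

  `TwoScaleReduction → TorusHyperuniformity → EnergyConvexityWindow → LandauToPeriodicBEC →
    BoundaryTransferWeak → BoseEinsteinCondensation`

(the audited sub-problem abbrev `_root_.BoseEinsteinCondensation`, by name).

The composition is pure logic. For an admissible potential `v` (`IsRepulsiveFiniteRange v`):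
* `TwoScaleReduction v hv` is, verbatim, "`TorusHyperuniformity`'s body for `v` → `LandauSectorBound`'s
  body for `v`", so `TwoScaleReduction v hv (TorusHyperuniformity v hv)` is Landau's sector bound for `v`
  (this is the glue item `CruxesToLandauSectorBound`, inlined);
* `LandauToPeriodicBEC v hv` takes `EnergyConvexityWindow`'s body for `v` and Landau's sector bound for
  `v` to the periodic-BEC body for `v`;
* `BoundaryTransferWeak v hv` takes the periodic-BEC body for `v` to
  `∃ ρ₀ > 0, ∀ ρ ∈ (0, ρ₀), HasGroundStateBEC v ρ`, which is the conjunct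
  `Literature.MathematicalPhysics.QuantumManyBody.BoseGas.BoseEinsteinCondensation` at `v`.
This is exactly the route's deciding theorem `closes` precomposed with the glue; it is spelled out
term-by-term so that this file depends only on the item statements.

References: [LSSY2005, §1.2 and Ch. 5] (the conjunct being assembled), [Stringari1995]
(the sum-rule mechanism behind the bridge `LandauToPeriodicBEC`). No analytic content lives here.
-/

namespace Summit.AtomisticToContinuum.BoseEinsteinCondensation.Theorems

open Summit.AtomisticToContinuum.BoseEinsteinCondensation.Theses.BECSectorPoincareTwoScale in
/-- **Item stmt-AtomisticToContinuum-9098** (`Assembly` of route `BECSectorPoincareTwoScale`, exact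
route decl): given `hTS : TwoScaleReduction`, `hHU : TorusHyperuniformity`,
`hC : EnergyConvexityWindow`, `hB : LandauToPeriodicBEC` and `hT : BoundaryTransferWeak`, for every
repulsive finite-range `v` the term `hTS v hv (hHU v hv)` is Landau's sector bound for `v`,
`hB v hv (hC v hv) (hTS v hv (hHU v hv))` is periodic BEC for `v`, and `hT v hv` of it is
ground-state BEC for `v` at all small densities, i.e. the conjunct `BoseEinsteinCondensation` at `v`.
Pure composition of the route's hypotheses (the route's deciding theorem `closes` after the glue
`CruxesToLandauSectorBound`, both inlined). [folklore] -/
theorem becSectorPoincareTwoScale_assembly_proof :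
    Summit.AtomisticToContinuum.BoseEinsteinCondensation.Theses.BECSectorPoincareTwoScale.Assembly := by
  unfold Theses.BECSectorPoincareTwoScale.Assembly
  intro hTS hHU hC hB hT v hv
  exact hT v hv (hB v hv (hC v hv) (hTS v hv (hHU v hv)))

end Summit.AtomisticToContinuum.BoseEinsteinCondensation.Theorems
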